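import Mathlib
import Summits.AtomisticToContinuum.Crystallization.Theses.PhononSlackCertificates

/-!
# Sketch — first lemmas of the three crux ideas for `PhononSlackCertificates.NearFieldConvexity`
(item stmt-AtomisticToContinuum-13958; crux-ideate round 1, ideator 1)

* Card `zero-stress-whitney-blocks`  : `prestress_rotation_null` (PROVED), `traction_half_stress` (stated).
* Card `hagg-word-riccati-barriers`  : `schurStep_antitone`, `barrier_two_blocks` (stated).
* Card `frame-free-star-certificate` : the transfer `PointwiseCalibratedNearField → NearFieldConvexity`
  (stated; pure bookkeeping, provable now).

Everything is over existing declarations (`lennardJones`, `IsTwoShellGood`, `triangularVec₁/₂`,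
`barlowOffset`, `haggLabel`, `layerNormal`, `IsHaggSeq`, `PeriodicConfiguration.energyPerParticle`,
`Matrix.PosSemidef`, `Matrix.PosDef`, `Matrix.fromBlocks`).  `sorry` only in statements that are not
claimed proved.
-/

noncomputable section

open scoped BigOperators InnerProductSpace Matrix ComplexOrder
open Literature.MathematicalPhysics.StatisticalMechanics Literature.Geometry.DiscreteGeometry

namespace Summit.AtomisticToContinuum.Crystallization.Cruxes.NearFieldConvexity.IdeatorOne

local notation "E3" => EuclideanSpace ℝ (Fin 3)

/-! ## Card A — zero-stress-whitney-blocks -/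

/-- ZERO PRESTRESS MOMENT of a weighted star of bond vectors: the symmetric tensor
`S = Σ_l c_l ζ_l ⊗ ζ_l` vanishes, written coordinate-free as `S : (Mᵀ N) = 0` for all linear `M, N`.
For the relaxed reference polytype `c_l = φ'(|ζ_l|²)` (tangent slope of `φ(s) = V_LJ(√s)` in the squared
length) and `S = ∂e/∂(strain) = 0` is the statement that the reference cell is relaxed. -/
def ZeroPrestressMoment {ι : Type*} (s : Finset ι) (c : ι → ℝ) (ζ : ι → E3) : Prop :=
  ∀ M N : E3 →ₗ[ℝ] E3, ∑ l ∈ s, c l * ⟪M (ζ l), N (ζ l)⟫_ℝ = 0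

/-- **First lemma of card A (proved): at zero prestress moment the prestress quadratic form is blind to
EVERY linear change of frame — in particular to finite rotations, with no smallness:**
`Σ_l c_l ‖A ζ_l − ζ_l‖² = 0` for every linear `A`.  (Used three times in the card: in-block rotations are
free, the monopole of the inter-block flux vanishes, the affine tangential part is null.) -/
theorem prestress_rotation_null {ι : Type*} (s : Finset ι) (c : ι → ℝ) (ζ : ι → E3)
    (hS : ZeroPrestressMoment s c ζ) (A : E3 →ₗ[ℝ] E3) :
    ∑ l ∈ s, c l * ‖A (ζ l) - ζ l‖ ^ 2 = 0 := by
  have h1 := hS A A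
  have h2 := hS A LinearMap.id
  have h3 := hS LinearMap.id LinearMap.id
  simp only [LinearMap.id_coe, id_eq] at h2 h3
  have key : ∀ l ∈ s, c l * ‖A (ζ l) - ζ l‖ ^ 2 =
      c l * ⟪A (ζ l), A (ζ l)⟫_ℝ - 2 * (c l * ⟪A (ζ l), ζ l⟫_ℝ) + c l * ⟪ζ l, ζ l⟫_ℝ := by
    intro l _
    rw [norm_sub_sq_real, ← real_inner_self_eq_norm_sq, ← real_inner_self_eq_norm_sq]
    ring
  rw [Finset.sum_congr rfl key, Finset.sum_add_distrib, Finset.sum_sub_distrib, ← Finset.mul_sum,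
    h1, h2, h3]
  ring

/-- Second statement of card A (stated, elementary): for a CENTRALLY SYMMETRIC weighted bond star
(an involution `σ` with `ζ (σ l) = −ζ l`, `c (σ l) = c l`) the traction transmitted across a plane with
normal `n` — the sum over bonds crossing the plane upward — is HALF the stress applied to `n`:
`Σ_l (ζ_l·n)₊ c_l ζ_l = ½ Σ_l c_l (ζ_l·n) ζ_l`.  With zero prestress moment the right side vanishes for
every `n`: the boundary force distribution of a block cut along a lattice plane has NO MONOPOLE, it is a
double layer (card A, flux lemma). -/
theorem traction_half_stress {ι : Type*} [Fintype ι] (c : ι → ℝ) (ζ : ι → E3) (σ : ι ≃ ι)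
    (hζ : ∀ l, ζ (σ l) = -ζ l) (hc : ∀ l, c (σ l) = c l) (n : E3) :
    ∑ l, (max ⟪ζ l, n⟫_ℝ 0 * c l) • ζ l = (1 / 2 : ℝ) • ∑ l, (c l * ⟪ζ l, n⟫_ℝ) • ζ l := by
  sorry

/-! ## Card B — hagg-word-riccati-barriers -/

/-- **First lemma of card B (stated): the Schur/Riccati step `X ↦ A − Bᴴ X⁻¹ B` is MONOTONE in the
Loewner order on positive definite `X`.**  Hence an order-interval of pivots is mapped into the
order-interval spanned by the images of its two endpoints, and a family of positive definite LOWER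
BARRIERS indexed by local Hägg words certifies positivity of the layer-chain operator of EVERY stacking
sequence by finitely many matrix inequalities. -/
theorem schurStep_antitone {m k : ℕ} (A : Matrix (Fin m) (Fin m) ℂ) (B : Matrix (Fin k) (Fin m) ℂ)
    (X Y : Matrix (Fin k) (Fin k) ℂ) (hX : X.PosDef) (hY : Y.PosDef) (hXY : (Y - X).PosSemidef) :
    ((A - Bᴴ * Y⁻¹ * B) - (A - Bᴴ * X⁻¹ * B)).PosSemidef := by
  sorry

/-- Card B, barrier ⇒ positivity (two-block case; the chain case is its iteration): if a positive
definite barrier `X` sits below the first pivot, `X ≤ A`, and the barrier-Schur complement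
`D − Bᴴ X⁻¹ B` is positive semidefinite, then the block operator `[[A, B], [Bᴴ, D]]` is positive
semidefinite.  (From `schurStep_antitone` and `Matrix.PosSemidef.fromBlocks₁₁`.) -/
theorem barrier_two_blocks {m k : ℕ} (A X : Matrix (Fin m) (Fin m) ℂ) (B : Matrix (Fin m) (Fin k) ℂ)
    (D : Matrix (Fin k) (Fin k) ℂ) (hA : A.IsHermitian) (hD : D.IsHermitian) (hX : X.PosDef)
    (hXA : (A - X).PosSemidef) (hS : (D - Bᴴ * X⁻¹ * B).PosSemidef) :
    (Matrix.fromBlocks A B Bᴴ D).PosSemidef := by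
  sorry

/-! ## Card C — frame-free-star-certificate (transfer to a POINTWISE calibrated inequality) -/

/-- Site `(m, i, j)` of the layered template (verbatim the generic element of the set `S` in the crux). -/
def layeredPos (a : ℝ) (s : ℤ → ℤ) (z : ℤ → ℝ) (l : ℤ × ℤ × ℤ) : E3 :=
  ((l.2.1 : ℝ) • triangularVec₁ a) + ((l.2.2 : ℝ) • triangularVec₂ a) +
    ((haggLabel s l.1 : ℝ) • barlowOffset a) + (z l.1 • layerNormal 1)

/-- The relaxation box of the crux: `a ∈ [47/50, 1]`, interlayer increments in `[39a/50, 17a/20]`. -/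
def InBox (a : ℝ) (z : ℤ → ℝ) : Prop :=
  47 / 50 ≤ a ∧ a ≤ 1 ∧ ∀ m : ℤ, 39 / 50 * a ≤ z (m + 1) - z m ∧ z (m + 1) - z m ≤ 17 / 20 * a

/-- The crux's local predicate: the 2-ball of particle `i` is two-way `η`-matched, after a translation,
to a rigid image of a layered template in the box (verbatim the negated set in `NearFieldConvexity`). -/
def LayeredNear {N : ℕ} (η : ℝ) (x : Fin N → E3) (i : Fin N) : Prop :=
  ∃ (A : E3 →ₗᵢ[ℝ] E3) (t : E3) (a : ℝ) (s : ℤ → ℤ) (z : ℤ → ℝ), 47 / 50 ≤ a ∧ a ≤ 1 ∧ IsHaggSeq s ∧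
    (∀ m : ℤ, 39 / 50 * a ≤ z (m + 1) - z m ∧ z (m + 1) - z m ≤ 17 / 20 * a) ∧
    let S : Set E3 := {p | ∃ m i j : ℤ, p = A (((i : ℝ) • triangularVec₁ a) + ((j : ℝ) • triangularVec₂ a) +
      ((haggLabel s m : ℝ) • barlowOffset a) + (z m • layerNormal 1))}
    (∀ j : Fin N, dist (x j) (x i) ≤ 2 → ∃ p ∈ S, dist (x j + t) p ≤ η) ∧
      (∀ p ∈ S, dist p (x i + t) ≤ 2 → ∃ j : Fin N, dist (x j + t) p ≤ η)

/-- Site-energy excess `e_i − e*`, `e_i = ½ Σ_{j ≠ i} V_LJ(|x_i − x_j|)`, `e* = ⨅_Q e(Q)` (as in the crux). -/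
def siteExcess {N : ℕ} (x : Fin N → E3) (i : Fin N) : ℝ :=
  (1 / 2 : ℝ) * (∑ j ∈ Finset.univ.erase i, lennardJones (dist (x i) (x j))) -
    (⨅ Q : PeriodicConfiguration 3, Q.energyPerParticle lennardJones)

/-- `good x i` = the crux's selector `IsTwoShellGood (1/20) (47/50) 1 x i`. -/
abbrev good {N : ℕ} (x : Fin N → E3) (i : Fin N) : Prop := IsTwoShellGood (1 / 20) (47 / 50) 1 x i

/-- **C⁺ — POINTWISE CALIBRATED NEAR FIELD (the transfer target of card C).**  For every `δ, η` there
are `c > 0`, `C` such that every `δ`-separated configuration admits an antisymmetric TRANSFER `τ`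
(built in the card from compact self-stress / Cayley–Menger multipliers of the labelled tet–oct star
complex, frame-free) and a nonnegative FAR SLACK `g` with
(i) POINTWISE: at every particle whose closed 4-ball consists of good particles,
    `c · 𝟙[¬ LayeredNear η] ≤ (e_i − e*) + Σ_j τ i j + g i`;
(ii) SUMMABILITY (pure geometry of `δ`-separated sets, shared with the far field): for every set `Ω`
    of good particles, the far slack and the transfer flux leaving the radius-4 interior of `Ω` are
    bounded by `C` times the crux's boundary count.
No `N`, no `Ω` and no boundary appear in (i): it is a statement about ONE site and its environment. -/
def PointwiseCalibratedNearField : Prop :=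
  ∀ δ : ℝ, 0 < δ → ∀ η : ℝ, 0 < η → ∃ c : ℝ, 0 < c ∧ ∃ C : ℝ, ∀ (N : ℕ) (x : Fin N → E3),
    (∀ i j : Fin N, i ≠ j → δ ≤ dist (x i) (x j)) →
    ∃ (τ : Fin N → Fin N → ℝ) (g : Fin N → ℝ), (∀ i j, τ i j = -τ j i) ∧ (∀ i, 0 ≤ g i) ∧
      (∀ i : Fin N, (∀ j : Fin N, dist (x j) (x i) ≤ 4 → good x j) →
        0 ≤ siteExcess x i + (∑ j, τ i j) + g i ∧
          (¬ LayeredNear η x i → c ≤ siteExcess x i + (∑ j, τ i j) + g i)) ∧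
      (∀ Ω : Finset (Fin N), (∀ i ∈ Ω, good x i) →
        (∑ i ∈ Ω.filter (fun i => ∀ j : Fin N, dist (x j) (x i) ≤ 4 → j ∈ Ω),
            (g i + ∑ j ∈ Finset.univ.filter (fun j => ¬ (j ∈ Ω ∧ ∀ k : Fin N, dist (x k) (x j) ≤ 4 → k ∈ Ω)),
              |τ i j|)) ≤
          C * (Nat.card {i : Fin N // i ∈ Ω ∧ ∃ j : Fin N, j ∉ Ω ∧ dist (x j) (x i) ≤ 4} : ℝ))

/-- **First lemma of card C (stated; bookkeeping, provable now): C⁺ ⇒ the crux BY NAME.**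
Interior sites: sum (i), internal transfers cancel by antisymmetry, the outgoing flux and the far slack
are paid by (ii); boundary sites: `|e_i − e*| ≤ C₀(δ)` by `δ`-separation (`sum_inv_pow_six_le`-type
bound); `#NL(Ω) ≤ #NL(interior) + #∂₄Ω`. -/
theorem nearFieldConvexity_of_pointwise (h : PointwiseCalibratedNearField) :
    Summit.AtomisticToContinuum.Crystallization.Theses.PhononSlackCertificates.NearFieldConvexity := by
  sorry

end Summit.AtomisticToContinuum.Crystallization.Cruxes.NearFieldConvexity.IdeatorOne
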